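import Mathlib
import Literature.RingTheory.MvPolynomial.WeightMonomialOrder
import Literature.RingTheory.MvPolynomial.LeadingExponents
import Summits.ResolutionOfSingularities.ResolutionOfSingularities.Theorems.TropicalLinksSchonResolvesWeightLexTop

/-!
# TropicalLinks / SchonResolves — `E_m(in_w(I)) = E_{≺_{w,m}}(I)` (Gröbner basics GB2)

Route `ResolutionOfSingularities/TropicalLinks`, crux `SchonResolves` (stmt-ResolutionOfSingularities-17234),
line `zariski-toric-closure`, stub GB2: for a weight `w : σ → ℕ`, a monomial order `m`, the weight
monomial order `≺_{w,m}` (tree `Literature.RingTheory.MvPolynomial.weightLex`) and an ideal `I` of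
`k[X_σ]`, the `m`-leading exponents of the initial ideal `in_w(I) := ⟨in_w f : f ∈ I⟩` are the
`≺_{w,m}`-leading exponents of `I`:
`E_m(in_w(I)) = E_{≺_{w,m}}(I)` — the exponent form of `in_≺(in_w I) = in_{≺_w}(I)`.
Here `in_w f = weightedHomogeneousComponent w (weightedTotalDegree w f) f` (top `w`-component,
max-convention; no new definitions).

* `schonResolves_weightedHomogeneousComponent_monomial_mul_of_le` / `…_of_not_le` — the weighted
  components of a product with a monomial left factor `a X^u`;
* `schonResolves_exists_mem_weightedHomogeneousComponent_eq_of_mem_span` — **every weighted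
  component of a member of `in_w(I)` is the top component of a member of `I`** (componentwise,
  with a weight bound): proved by span induction, reducing ring multipliers to monomials;
* `schonResolves_leadingExponents_span_topComponent` (GB2, the registered stub).

Proof of GB2. (⊇) by GB1 (`schonResolves_degree_weightLex_eq_degree_topComponent`):
`deg_{≺_{w,m}} f = deg_m (in_w f)` with `in_w f ≠ 0` a generator of `in_w(I)`. (⊆) if
`a = deg_m g`, `g ∈ in_w(I)`, `g ≠ 0`, put `n := ⟨w, a⟩`; the weight-`n` component `g_n` of `g`
still has `deg_m g_n = a`, and by the componentwise lemma `g_n = in_w F` for some `F ∈ I` with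
`wdeg F = n`, `F ≠ 0`; then `a = deg_m (in_w F) = deg_{≺_{w,m}} F` by GB1.
References: Sturmfels, *Gröbner Bases and Convex Polytopes*, Ch. 1 (before Prop. 1.8);
Cox–Little–O'Shea, Ch. 2 §4, Exercises 11–12 (weight orders).
-/

-- single-problem summit: the doubled namespace component `ResolutionOfSingularities` is forced
set_option linter.dupNamespace false

namespace Summit.ResolutionOfSingularities.ResolutionOfSingularities.Theorems

open MvPolynomial

/-- **Components of a product with a monomial left factor**: if `⟨w, u⟩ ≤ n` then
`(a X^u · g)_n = a X^u · g_{n - ⟨w,u⟩}`. [folklore] -/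
theorem schonResolves_weightedHomogeneousComponent_monomial_mul_of_le {σ : Type*} {R : Type*}
    [CommSemiring R] (w : σ → ℕ) (u : σ →₀ ℕ) (a : R) {n : ℕ} (h : Finsupp.weight w u ≤ n)
    (g : MvPolynomial σ R) :
    weightedHomogeneousComponent w n (monomial u a * g) =
      monomial u a * weightedHomogeneousComponent w (n - Finsupp.weight w u) g := by
  classical
  ext e
  simp only [coeff_weightedHomogeneousComponent, coeff_monomial_mul']
  by_cases hue : u ≤ e
  · -- `⟨w, e⟩ = ⟨w, u⟩ + ⟨w, e - u⟩`
    have hwe : Finsupp.weight w e = Finsupp.weight w u + Finsupp.weight w (e - u) := by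
      rw [← map_add, add_tsub_cancel_of_le hue]
    by_cases hn : Finsupp.weight w (e - u) = n - Finsupp.weight w u
    · rw [if_pos hn, if_pos hue, if_pos (by omega)]
    · rw [if_neg hn, if_neg (by omega), if_pos hue, mul_zero]
  · rw [if_neg hue, if_neg hue, ite_self]

/-- **Components of a product with a monomial left factor**: if `¬ ⟨w, u⟩ ≤ n` then
`(a X^u · g)_n = 0`. [folklore] -/
theorem schonResolves_weightedHomogeneousComponent_monomial_mul_of_not_le {σ : Type*}
    {R : Type*} [CommSemiring R] (w : σ → ℕ) (u : σ →₀ ℕ) (a : R) {n : ℕ}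
    (h : ¬ Finsupp.weight w u ≤ n) (g : MvPolynomial σ R) :
    weightedHomogeneousComponent w n (monomial u a * g) = 0 := by
  classical
  ext e
  rw [coeff_weightedHomogeneousComponent, coeff_monomial_mul', coeff_zero]
  by_cases hue : u ≤ e
  · have hwe : Finsupp.weight w e = Finsupp.weight w u + Finsupp.weight w (e - u) := by
      rw [← map_add, add_tsub_cancel_of_le hue]
    rw [if_neg (by omega)]
  · rw [if_neg hue, ite_self]

/-- **Members of `in_w(I)` are initial forms, componentwise.** For every member `g` of the ideal
`in_w(I) = ⟨in_w f : f ∈ I⟩` and every weight `n` there is `F ∈ I` all of whose exponents have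
weight `≤ n` and whose weight-`n` component is the weight-`n` component of `g` (so `in_w F = g_n`
whenever `g_n ≠ 0`). Proof by span induction: for a generator `in_w f` take `F = f` (or `0`), and a
multiplier `c` is reduced to monomials `X^u`, for which `(X^u g)_n = X^u g_{n - ⟨w,u⟩}`.
[cite: Sturmfels1996GBCP, Ch. 1 (before Prop. 1.8)] -/
theorem schonResolves_exists_mem_weightedHomogeneousComponent_eq_of_mem_span {σ : Type*}
    {R : Type*} [CommSemiring R] (w : σ → ℕ) (I : Ideal (MvPolynomial σ R)) {g : MvPolynomial σ R}
    (hg : g ∈ Ideal.span ((fun f : MvPolynomial σ R =>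
      weightedHomogeneousComponent w (weightedTotalDegree w f) f) '' (I : Set (MvPolynomial σ R))))
    (n : ℕ) :
    ∃ F ∈ I, (∀ d ∈ F.support, Finsupp.weight w d ≤ n) ∧
      weightedHomogeneousComponent w n F = weightedHomogeneousComponent w n g := by
  classical
  induction hg using Submodule.span_induction generalizing n with
  | mem x hx =>
    -- a generator `in_w f`, `f ∈ I`: take `F = f` if `n = wdeg f`, else `F = 0`
    obtain ⟨f, hf, rfl⟩ := hx
    by_cases hn : n = weightedTotalDegree w f
    · refine ⟨f, hf, fun d hd => hn ▸ le_weightedTotalDegree w hd, ?_⟩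
      rw [hn, (weightedHomogeneousComponent_isWeightedHomogeneous _ f).weightedHomogeneousComponent_same]
    · refine ⟨0, I.zero_mem, fun d hd => ?_, ?_⟩
      · simp only [support_zero, Finset.notMem_empty] at hd
      · rw [map_zero, (weightedHomogeneousComponent_isWeightedHomogeneous _ f).weightedHomogeneousComponent_ne n hn]
  | zero => exact ⟨0, I.zero_mem, fun d hd => by simp only [support_zero, Finset.notMem_empty] at hd, rfl⟩
  | add x y _ _ hx hy =>
    obtain ⟨F, hFI, hFw, hFx⟩ := hx n
    obtain ⟨G, hGI, hGw, hGy⟩ := hy n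
    refine ⟨F + G, I.add_mem hFI hGI, fun d hd => ?_, by rw [map_add, map_add, hFx, hGy]⟩
    rcases Finset.mem_union.1 (support_add hd) with h | h
    exacts [hFw d h, hGw d h]
  | smul c x _ hx =>
    -- reduce the multiplier `c` to monomials
    induction c using MvPolynomial.induction_on' generalizing n with
    | monomial u a =>
      by_cases hun : Finsupp.weight w u ≤ n
      · obtain ⟨F, hFI, hFw, hFx⟩ := hx (n - Finsupp.weight w u)
        refine ⟨monomial u a * F, I.mul_mem_left _ hFI, fun d hd => ?_, ?_⟩
        · obtain ⟨u', hu', e, he, rfl⟩ := Finset.mem_add.1 (support_mul _ _ hd)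
          rw [Finset.mem_singleton.1 (support_monomial_subset hu'), map_add]
          have := hFw e he
          omega
        · rw [smul_eq_mul, schonResolves_weightedHomogeneousComponent_monomial_mul_of_le w u a hun,
            schonResolves_weightedHomogeneousComponent_monomial_mul_of_le w u a hun, hFx]
      · refine ⟨0, I.zero_mem, fun d hd => ?_, ?_⟩
        · simp only [support_zero, Finset.notMem_empty] at hd
        · rw [map_zero, smul_eq_mul,
            schonResolves_weightedHomogeneousComponent_monomial_mul_of_not_le w u a hun]
    | add p q hp hq =>
      obtain ⟨F, hFI, hFw, hFx⟩ := hp n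
      obtain ⟨G, hGI, hGw, hGy⟩ := hq n
      refine ⟨F + G, I.add_mem hFI hGI, fun d hd => ?_, ?_⟩
      · rcases Finset.mem_union.1 (support_add hd) with h | h
        exacts [hFw d h, hGw d h]
      · rw [add_smul, map_add, map_add, hFx, hGy]

/-- **GB2 — `E_m(in_w(I)) = E_{≺_{w,m}}(I)`.** For a field `k`, a weight `w : σ → ℕ`, a monomial
order `m` and an ideal `I ⊆ k[X_σ]`, the `m`-leading exponents of the initial ideal
`in_w(I) = ⟨in_w f : f ∈ I⟩` are exactly the leading exponents of `I` for the weight order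
`≺_{w,m}` (the exponent form of `in_≺(in_w I) = in_{≺_w}(I)`).
[cite: Sturmfels1996GBCP, Ch. 1 (weight term orders, before Prop. 1.8)] -/
theorem schonResolves_leadingExponents_span_topComponent : ∀ (k : Type) [Field k] (σ : Type) (w : σ → ℕ) (m : MonomialOrder σ) (I : Ideal (MvPolynomial σ k)), Literature.RingTheory.MvPolynomial.leadingExponents m (Ideal.span ((fun f : MvPolynomial σ k => MvPolynomial.weightedHomogeneousComponent w (MvPolynomial.weightedTotalDegree w f) f) '' (I : Set (MvPolynomial σ k)))) = Literature.RingTheory.MvPolynomial.leadingExponents (Literature.RingTheory.MvPolynomial.weightLex w m) I := by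
  intro k _ σ w m I
  classical
  ext a
  simp only [Literature.RingTheory.MvPolynomial.mem_leadingExponents]
  constructor
  · rintro ⟨g, hg, hg0, rfl⟩
    -- the weight-`n` component of `g`, `n := ⟨w, deg_m g⟩`, has the same `m`-degree
    obtain ⟨n, hn⟩ : ∃ n, n = Finsupp.weight w (m.degree g) := ⟨_, rfl⟩
    have hmem : m.degree g ∈ (weightedHomogeneousComponent w n g).support := by
      rw [mem_support_iff, coeff_weightedHomogeneousComponent, if_pos hn.symm]
      exact m.coeff_degree_ne_zero_iff.mpr hg0
    have hdeg : m.degree (weightedHomogeneousComponent w n g) = m.degree g := by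
      refine schonResolves_degree_eq_of_mem_support_of_forall_le m hmem fun d hd => m.le_degree ?_
      rw [support_weightedHomogeneousComponent, Finset.mem_filter] at hd
      exact hd.1
    -- it is the top component of some `F ∈ I`
    obtain ⟨F, hFI, hFw, hFn⟩ :=
      schonResolves_exists_mem_weightedHomogeneousComponent_eq_of_mem_span w I hg n
    have hne : weightedHomogeneousComponent w n F ≠ 0 := by
      rw [hFn]
      intro h0
      rw [h0, support_zero] at hmem
      exact Finset.notMem_empty _ hmem
    have hF0 : F ≠ 0 := by
      rintro rfl
      exact hne (map_zero _)
    have hwtd : weightedTotalDegree w F = n := by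
      refine le_antisymm (Finset.sup_le hFw) ?_
      obtain ⟨e, he⟩ := support_nonempty.mpr hne
      rw [support_weightedHomogeneousComponent, Finset.mem_filter] at he
      rw [← he.2]
      exact le_weightedTotalDegree w he.1
    refine ⟨F, hFI, hF0, ?_⟩
    rw [(schonResolves_degree_weightLex_eq_degree_topComponent k σ w m F hF0).1, hwtd, hFn, hdeg]
  · rintro ⟨f, hf, hf0, rfl⟩
    obtain ⟨hdeg, hne, -⟩ := schonResolves_degree_weightLex_eq_degree_topComponent k σ w m f hf0
    exact ⟨_, Ideal.subset_span ⟨f, hf, rfl⟩, hne, hdeg.symm⟩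

end Summit.ResolutionOfSingularities.ResolutionOfSingularities.Theorems
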